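import Literature.NumberTheory.Automorphic.PureTensorCuspForm
import Literature.NumberTheory.Automorphic.FinWhittakerProductFormula
import Literature.NumberTheory.Automorphic.ArchWhittakerTranslate
import Literature.NumberTheory.Automorphic.RankinSelbergTorusIntegral
import HarnessLib

/-!
# The Whittaker function of a pure tensor cusp form is Eulerian: its values at points that are
# integral off a finite set of places (Cogdell (2004), §1.1 Cor. 1.4 with §2.3; Jacquet–Langlands (1970), p. 171)

Topic `NumberTheory/Automorphic`; namespace `Literature.NumberTheory.Automorphic`. Theorems only (no
definition, no named fact, no instance).

Let `Π ≤ L²_cusp(GL_n)` be cuspidal with archimedean component `τ`, `π_f = M` its finite component realised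
(Flath) as a restricted tensor product `j : ⊗'_v (V_v, x₀_v) → M` of irreducible admissible `ρ_v` with
spherical vectors `x₀_v` at almost all `v`, with local `ψ_v`-Whittaker functionals `λ_v`, unit vectors
`e_v` (`λ_v(e_v) = 1`) and the product formula for the `ψ_f`-Whittaker functional `Λ₀` of `M`
(`exists_finWhittaker_prod_formula` of `FinWhittakerProductFormula`, Cogdell (2004), Cor. 1.4):

  `Λ₀(g_f · j(x)) = Λ₀(j(e_S)) · ∏_{v ∈ S} λ_v(ρ_v(g_v) x_v)`  whenever `ρ_v(g_v) x_v = x₀_v` for `v ∉ S`.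

Combined with the factorisation `W_φ(g) = Λ₀(g_f · T) · ℓ_∞(τ(g_∞) e)` of the Whittaker function of the cusp
form `φ = invQuot (contRep (T̂ e))` of a pure tensor (`whittakerDepth_zero_invQuot_contRep_pureTensor` of
`PureTensorCuspForm`) this gives the Euler factorisation of `W_φ` for `φ = e ⊗ j(x)`:

* `whittakerDepth_zero_pureTensor_eq_mul_prod` — for `g ∈ GL_n(𝔸_K)` and a finite set `S` of finite places
  with `ρ_v(g_v) x_v = x₀_v` for all `v ∉ S`:

    `W_φ(g) = Λ₀(j(e_S)) · (∏_{v ∈ S} λ_v(ρ_v(g_v) x_v)) · ℓ_∞(τ(g_∞) e)`;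

* `restrictedPiEquiv_sndHom_eq_localComponent`, `restrictedPiEquiv_sndHom_glDiagonal` — the `v`-component of
  `g_f` is the `v`-component `localComponent v g`, and for a diagonal idelic torus element `diag(b)`,
  `b ∈ (𝔸_Kˣ)ⁿ`, it is `diag(b_v)` (`b_{i,v} = finComp v (b i)` as units of `K_v`);
* `whittakerDepth_zero_pureTensor_glDiagonal` — **MAIN** (the torus points of the Hecke / Rankin–Selberg
  integrals): if `x_v = x₀_v` is the spherical vector and `b` is a unit at every `v ∉ S`
  (`|b_{i,v}|_v = 1`), then

    `W_φ(diag(b)) = Λ₀(j(e_S)) · (∏_{v ∈ S} λ_v(ρ_v(diag(b_v)) x_v)) · ℓ_∞(τ(diag(b_∞)) e)`,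

  `b_∞ = archTorusOfIdele b` — on the box `{b | b_v ∈ (𝒪_vˣ)ⁿ, v ∉ S}` the Whittaker function of the pure
  tensor is the archimedean Whittaker function times the product over `S` of the local Whittaker functions
  `W_v(h) = λ_v(ρ_v(h) x_v)` (Cogdell (2004), §2.3: "`W_φ(g) = ∏_v W_{φ_v}(g_v)` … for `v ∉ S`,
  `W_{φ_v}(k_v) = 1`"; Jacquet–Langlands (1970), p. 171, the factorisation of `W_φ(diag(a, 1))` used in the
  Euler product (11.1.2) of the global Hecke integral);
* `whittakerDepth_zero_pureTensor_glDiagonal_extend` — the same with the local vectors outside `S` not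
  named (`x = extend S t`).

## References

* J. W. Cogdell, *Lectures on L-functions, converse theorems, and functoriality for GL_n*, Fields Inst.
  Monogr. 20 (2004), §1.1 Cor. 1.4, §2.3 (proof of Thm. 2.2) [CogdellAnalyticTheory2004].
* H. Jacquet, R. P. Langlands, *Automorphic Forms on GL(2)*, LNM 114 (1970), §11, p. 171 [JacquetLanglands1970].
* D. Flath, *Decomposition of representations into tensor products*, Proc. Sympos. Pure Math. 33 (1979),
  Part 1, Thm. 3 [FlathCorvallis1979].
-/

noncomputable section

open MeasureTheory Measure NumberField NumberField.mixedEmbedding IsDedekindDomain Set Filter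
open Literature.NumberTheory.GaloisRepresentations (ideleGroup)
open scoped MatrixGroups InnerProductSpace Classical NNReal

namespace Literature.NumberTheory.Automorphic

variable {n : ℕ} {K : Type} [Field K] [NumberField K]
  {μ : Measure (AdelicGroupData.gl n K).automorphicQuotient}
  [(AdelicGroupData.gl n K).IsAutomorphicMeasure μ]

-- the house Borel structures on `GL_n(𝔸_K)` (as in `PureTensorCuspForm`, whose theorems are specialised)
attribute [local instance] adelicBorel borelSpace_adelic locallyCompactSpace_adelic
  secondCountableTopology_gl_adelic glAdeleBorel borelSpace_glAdele

set_option backward.isDefEq.respectTransparency false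

/-! ### 1. Local components of finite-adelic points -/

section Components

/-- The `v`-component of `g_f = GLn.sndHom g` in the restricted product is `localComponent v g`
(both are the images of `g` under the evaluation `𝔸_K → K_v`). [folklore] -/
theorem restrictedPiEquiv_sndHom_eq_localComponent (g : GL (Fin n) (AdeleRing (𝓞 K) K))
    (v : HeightOneSpectrum (𝓞 K)) :
    GLn.restrictedPiEquiv n K (GLn.sndHom n K g) v = localComponent v g :=
  Units.ext (Matrix.ext fun _ _ => rfl)

/-- **The `v`-component of a diagonal idelic torus element is the diagonal of the `v`-components**:
`(diag(b))_{f,v} = diag(b_{·,v})` with `b_{i,v} = finComp v (b i) ∈ K_vˣ`. [folklore] -/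
theorem restrictedPiEquiv_sndHom_glDiagonal (b : Fin n → ideleGroup K) (v : HeightOneSpectrum (𝓞 K)) :
    GLn.restrictedPiEquiv n K (GLn.sndHom n K (glDiagonal n (AdeleRing (𝓞 K) K) b)) v =
      glDiagonal n (v.adicCompletion K) fun i =>
        (GaloisRepresentations.ideleGroup.finComp (K := K) v).toHomUnits (b i) := by
  refine Units.ext (Matrix.ext fun i k => ?_)
  rw [restrictedPiEquiv_sndHom_eq_localComponent, coe_glDiagonal]
  change AdelicGroupData.adeleEval K v
      (((glDiagonal n (AdeleRing (𝓞 K) K) b : GL (Fin n) (AdeleRing (𝓞 K) K)) :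
        Matrix (Fin n) (Fin n) (AdeleRing (𝓞 K) K)) i k) = _
  rw [coe_glDiagonal]
  by_cases hik : i = k
  · subst hik
    rw [Matrix.diagonal_apply_eq, Matrix.diagonal_apply_eq]
    rfl
  · rw [Matrix.diagonal_apply_ne _ hik, Matrix.diagonal_apply_ne _ hik, map_zero]

/-- **A diagonal idelic torus element that is a unit at `v` has `v`-component in `GL_n(𝒪_v)`**, so it fixes
every `GL_n(𝒪_v)`-fixed vector. [folklore] -/
theorem apply_restrictedPiEquiv_sndHom_glDiagonal_eq_of_mem_fixedPoints
    {V : Type*} [AddCommGroup V] [Module ℂ V] {v : HeightOneSpectrum (𝓞 K)}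
    (ρ : Representation ℂ (GL (Fin n) (v.adicCompletion K)) V) {x : V}
    (hx : x ∈ ρ.fixedPoints (glInt n (v.adicCompletion K))) {b : Fin n → ideleGroup K}
    (hb : ∀ i, Valued.v (((b i : ideleGroup K) : AdeleRing (𝓞 K) K).2 v) = 1) :
    ρ (GLn.restrictedPiEquiv n K (GLn.sndHom n K (glDiagonal n (AdeleRing (𝓞 K) K) b)) v) x = x := by
  rw [restrictedPiEquiv_sndHom_eq_localComponent]
  exact hx ⟨_, localComponent_glDiagonal_mem_glInt hb⟩

end Components

/-! ### 2. The Euler factorisation of the Whittaker function of a pure tensor -/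

section Euler

variable {hcpt : isCompact_glFiniteIntegralLevel n K}
  {E : Type*} [NormedAddCommGroup E] [InnerProductSpace ℂ E] [CompleteSpace E]
  {τ : ContRepresentation ℂ (AutomorphyDatum.gl n K hcpt).arch.carrier E}
  {V : HeightOneSpectrum (𝓞 K) → Type*} [∀ v, AddCommGroup (V v)] [∀ v, Module ℂ (V v)]

/-- **`W_φ(g) = Λ₀(j(e_S)) · ∏_{v ∈ S} λ_v(ρ_v(g_v) x_v) · ℓ_∞(τ(g_∞) e)`** for the cusp form `φ` of the pure
tensor `e ⊗ j(x)`: the factorisation `W_φ(g) = Λ₀(g_f · j(x)) · ℓ_∞(τ(g_∞) e)`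
(`whittakerDepth_zero_invQuot_contRep_pureTensor`) followed by the product formula for `Λ₀` along Flath's
factorisation (the hypothesis `hprod`, a clause of `exists_finWhittaker_prod_formula`), valid as soon as
`ρ_v(g_v) x_v = x₀_v` off `S`. [cite: CogdellAnalyticTheory2004, §1.1 Cor. 1.4 and §2.3] -/
theorem whittakerDepth_zero_pureTensor_eq_mul_prod (P : CuspidalAutomorphicRepGL n K μ)
    (hτ : τ.IsStronglyContinuous) (hn : 1 ≤ n)
    (ν₀ : Measure ↥(adelicUnipotent n K)) [IsHaarMeasure ν₀]
    {T₀ : multiplicityModule hcpt τ P.1} {Λ₀ : multiplicityModule hcpt τ P.1 →ₗ[ℂ] ℂ}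
    (hΛ : ∀ T : multiplicityModule hcpt τ P.1,
      transferMap (whittakerFunctional ν₀ (continuous_adeleAddChar K)
        (ContRepresentation.Equiv.refl P.1.toContRep)) hτ T =
        Λ₀ T • transferMap (whittakerFunctional ν₀ (continuous_adeleAddChar K)
          (ContRepresentation.Equiv.refl P.1.toContRep)) hτ T₀)
    {ρ : ∀ v : HeightOneSpectrum (𝓞 K), Representation ℂ (GL (Fin n) (v.adicCompletion K)) (V v)}
    {x₀ : ∀ v, V v} {j : RestrictedFamily V x₀ → multiplicityModule hcpt τ P.1}
    {lam : ∀ v, Module.Dual ℂ (V v)} {eu : ∀ v, V v}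
    (hprod : ∀ (S : Finset (HeightOneSpectrum (𝓞 K))) (gf : GL (Fin n) (FiniteAdeleRing (𝓞 K) K))
      (x : RestrictedFamily V x₀), (∀ v ∉ S, ρ v (GLn.restrictedPiEquiv n K gf v) (x v) = x₀ v) →
      Λ₀ (finComponentRep hcpt τ P.1 gf (j x)) =
        Λ₀ (j (RestrictedFamily.extend S fun v : S => eu v)) *
          ∏ v ∈ S, lam v (ρ v (GLn.restrictedPiEquiv n K gf v) (x v)))
    (S : Finset (HeightOneSpectrum (𝓞 K))) (x : RestrictedFamily V x₀) (e : archGardingSpace hcpt τ)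
    (g : GL (Fin n) (AdeleRing (𝓞 K) K))
    (hg : ∀ v ∉ S, ρ v (GLn.restrictedPiEquiv n K (GLn.sndHom n K g) v) (x v) = x₀ v) :
    whittakerDepth 0 (invQuot (AdelicGroupData.gl n K)
        (contRep (((j x : multiplicityModule hcpt τ P.1) : E →L[ℂ] (AdelicGroupData.gl n K).L2 μ) (e : E)))) g =
      Λ₀ (j (RestrictedFamily.extend S fun v : S => eu v)) *
        (∏ v ∈ S, lam v (ρ v (GLn.restrictedPiEquiv n K (GLn.sndHom n K g) v) (x v))) *
        transferMap (whittakerFunctional ν₀ (continuous_adeleAddChar K)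
          (ContRepresentation.Equiv.refl P.1.toContRep)) hτ T₀
          ⟨τ (toArch hcpt (GLn.toMixed n K g)) (e : E), apply_mem_archGardingSpace hτ _ e.2⟩ := by
  rw [whittakerDepth_zero_invQuot_contRep_pureTensor P hτ hn ν₀ hΛ (j x) e g, hprod S _ x hg]

/-- **MAIN. The Whittaker function of a pure tensor cusp form at diagonal torus points integral off `S`.**
With the data above, let `S` contain every place where the local vector `x_v` is not the distinguished
vector `x₀_v` or where `x₀_v` is not `GL_n(𝒪_v)`-fixed, and let `b ∈ (𝔸_Kˣ)ⁿ` be a unit at every `v ∉ S`.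
Then

  `W_φ(diag(b)) = Λ₀(j(e_S)) · (∏_{v ∈ S} λ_v(ρ_v(diag(b_v)) x_v)) · ℓ_∞(τ(diag(b_∞)) e)`,

`b_v = (finComp v (b i))_i ∈ (K_vˣ)ⁿ`, `b_∞ = archTorusOfIdele b ∈ ((K_∞)ˣ)ⁿ`: on the box of ideles integral
off `S` the Whittaker function of `φ = e ⊗ j(x)` is the product of the archimedean Whittaker function
`h ↦ ℓ_∞(τ(h) e)` and the local Whittaker functions `W_v(h) = λ_v(ρ_v(h) x_v)`, `v ∈ S` (Cogdell (2004), §2.3;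
Jacquet–Langlands (1970), p. 171). [cite: CogdellAnalyticTheory2004, §2.3] [cite: JacquetLanglands1970, §11 p. 171] -/
theorem whittakerDepth_zero_pureTensor_glDiagonal (P : CuspidalAutomorphicRepGL n K μ)
    (hτ : τ.IsStronglyContinuous) (hn : 1 ≤ n)
    (ν₀ : Measure ↥(adelicUnipotent n K)) [IsHaarMeasure ν₀]
    {T₀ : multiplicityModule hcpt τ P.1} {Λ₀ : multiplicityModule hcpt τ P.1 →ₗ[ℂ] ℂ}
    (hΛ : ∀ T : multiplicityModule hcpt τ P.1,
      transferMap (whittakerFunctional ν₀ (continuous_adeleAddChar K)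
        (ContRepresentation.Equiv.refl P.1.toContRep)) hτ T =
        Λ₀ T • transferMap (whittakerFunctional ν₀ (continuous_adeleAddChar K)
          (ContRepresentation.Equiv.refl P.1.toContRep)) hτ T₀)
    {ρ : ∀ v : HeightOneSpectrum (𝓞 K), Representation ℂ (GL (Fin n) (v.adicCompletion K)) (V v)}
    {x₀ : ∀ v, V v} {j : RestrictedFamily V x₀ → multiplicityModule hcpt τ P.1}
    {lam : ∀ v, Module.Dual ℂ (V v)} {eu : ∀ v, V v}
    (hprod : ∀ (S : Finset (HeightOneSpectrum (𝓞 K))) (gf : GL (Fin n) (FiniteAdeleRing (𝓞 K) K))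
      (x : RestrictedFamily V x₀), (∀ v ∉ S, ρ v (GLn.restrictedPiEquiv n K gf v) (x v) = x₀ v) →
      Λ₀ (finComponentRep hcpt τ P.1 gf (j x)) =
        Λ₀ (j (RestrictedFamily.extend S fun v : S => eu v)) *
          ∏ v ∈ S, lam v (ρ v (GLn.restrictedPiEquiv n K gf v) (x v)))
    (S : Finset (HeightOneSpectrum (𝓞 K))) (x : RestrictedFamily V x₀) (e : archGardingSpace hcpt τ)
    (hxS : ∀ v ∉ S, x v = x₀ v)
    (hfix : ∀ v ∉ S, x₀ v ∈ (ρ v).fixedPoints (glInt n (v.adicCompletion K)))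
    (b : Fin n → ideleGroup K) (hb : ∀ v ∉ S, ∀ i, Valued.v (((b i : ideleGroup K) : AdeleRing (𝓞 K) K).2 v) = 1) :
    whittakerDepth 0 (invQuot (AdelicGroupData.gl n K)
        (contRep (((j x : multiplicityModule hcpt τ P.1) : E →L[ℂ] (AdelicGroupData.gl n K).L2 μ) (e : E))))
        (glDiagonal n (AdeleRing (𝓞 K) K) b) =
      Λ₀ (j (RestrictedFamily.extend S fun v : S => eu v)) *
        (∏ v ∈ S, lam v (ρ v (glDiagonal n (v.adicCompletion K) fun i =>
          (GaloisRepresentations.ideleGroup.finComp (K := K) v).toHomUnits (b i)) (x v))) *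
        transferMap (whittakerFunctional ν₀ (continuous_adeleAddChar K)
          (ContRepresentation.Equiv.refl P.1.toContRep)) hτ T₀
          ⟨τ (toArch hcpt (glDiagonal n (mixedSpace K) (archTorusOfIdele n K b))) (e : E),
            apply_mem_archGardingSpace hτ _ e.2⟩ := by
  have hg : ∀ v ∉ S, ρ v (GLn.restrictedPiEquiv n K
      (GLn.sndHom n K (glDiagonal n (AdeleRing (𝓞 K) K) b)) v) (x v) = x₀ v := fun v hv => by
    rw [hxS v hv]
    exact apply_restrictedPiEquiv_sndHom_glDiagonal_eq_of_mem_fixedPoints (ρ v) (hfix v hv) (hb v hv)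
  have h := whittakerDepth_zero_pureTensor_eq_mul_prod P hτ hn ν₀ hΛ hprod S x e _ hg
  rw [h]
  have hprodS : (∏ v ∈ S, lam v (ρ v (GLn.restrictedPiEquiv n K
      (GLn.sndHom n K (glDiagonal n (AdeleRing (𝓞 K) K) b)) v) (x v))) =
      ∏ v ∈ S, lam v (ρ v (glDiagonal n (v.adicCompletion K) fun i =>
        (GaloisRepresentations.ideleGroup.finComp (K := K) v).toHomUnits (b i)) (x v)) :=
    Finset.prod_congr rfl fun v _ => by rw [restrictedPiEquiv_sndHom_glDiagonal]
  have harch : (⟨τ (toArch hcpt (GLn.toMixed n K (glDiagonal n (AdeleRing (𝓞 K) K) b))) (e : E),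
      apply_mem_archGardingSpace hτ _ e.2⟩ : archGardingSpace hcpt τ) =
      ⟨τ (toArch hcpt (glDiagonal n (mixedSpace K) (archTorusOfIdele n K b))) (e : E),
        apply_mem_archGardingSpace hτ _ e.2⟩ := by
    apply Subtype.ext
    change τ (toArch hcpt (GLn.toMixed n K (glDiagonal n (AdeleRing (𝓞 K) K) b))) (e : E) = _
    rw [toMixed_glDiagonal_eq_archTorusOfIdele]
  rw [hprodS, harch]

/-- The same at a pure tensor `e ⊗ j(extend S t)` whose local vectors outside `S` are the distinguished
ones: for `b` a unit off `S` (and `x₀_v` spherical off `S`),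
`W_φ(diag(b)) = Λ₀(j(e_S)) · (∏_{v ∈ S} λ_v(ρ_v(diag(b_v)) t_v)) · ℓ_∞(τ(diag(b_∞)) e)`.
[cite: CogdellAnalyticTheory2004, §2.3] -/
theorem whittakerDepth_zero_pureTensor_glDiagonal_extend (P : CuspidalAutomorphicRepGL n K μ)
    (hτ : τ.IsStronglyContinuous) (hn : 1 ≤ n)
    (ν₀ : Measure ↥(adelicUnipotent n K)) [IsHaarMeasure ν₀]
    {T₀ : multiplicityModule hcpt τ P.1} {Λ₀ : multiplicityModule hcpt τ P.1 →ₗ[ℂ] ℂ}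
    (hΛ : ∀ T : multiplicityModule hcpt τ P.1,
      transferMap (whittakerFunctional ν₀ (continuous_adeleAddChar K)
        (ContRepresentation.Equiv.refl P.1.toContRep)) hτ T =
        Λ₀ T • transferMap (whittakerFunctional ν₀ (continuous_adeleAddChar K)
          (ContRepresentation.Equiv.refl P.1.toContRep)) hτ T₀)
    {ρ : ∀ v : HeightOneSpectrum (𝓞 K), Representation ℂ (GL (Fin n) (v.adicCompletion K)) (V v)}
    {x₀ : ∀ v, V v} {j : RestrictedFamily V x₀ → multiplicityModule hcpt τ P.1}
    {lam : ∀ v, Module.Dual ℂ (V v)} {eu : ∀ v, V v}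
    (hprod : ∀ (S : Finset (HeightOneSpectrum (𝓞 K))) (gf : GL (Fin n) (FiniteAdeleRing (𝓞 K) K))
      (x : RestrictedFamily V x₀), (∀ v ∉ S, ρ v (GLn.restrictedPiEquiv n K gf v) (x v) = x₀ v) →
      Λ₀ (finComponentRep hcpt τ P.1 gf (j x)) =
        Λ₀ (j (RestrictedFamily.extend S fun v : S => eu v)) *
          ∏ v ∈ S, lam v (ρ v (GLn.restrictedPiEquiv n K gf v) (x v)))
    (S : Finset (HeightOneSpectrum (𝓞 K))) (t : ∀ v, V v) (e : archGardingSpace hcpt τ)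
    (hfix : ∀ v ∉ S, x₀ v ∈ (ρ v).fixedPoints (glInt n (v.adicCompletion K)))
    (b : Fin n → ideleGroup K) (hb : ∀ v ∉ S, ∀ i, Valued.v (((b i : ideleGroup K) : AdeleRing (𝓞 K) K).2 v) = 1) :
    whittakerDepth 0 (invQuot (AdelicGroupData.gl n K)
        (contRep (((j (RestrictedFamily.extend S fun v : S => t v) : multiplicityModule hcpt τ P.1) :
          E →L[ℂ] (AdelicGroupData.gl n K).L2 μ) (e : E))))
        (glDiagonal n (AdeleRing (𝓞 K) K) b) =
      Λ₀ (j (RestrictedFamily.extend S fun v : S => eu v)) *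
        (∏ v ∈ S, lam v (ρ v (glDiagonal n (v.adicCompletion K) fun i =>
          (GaloisRepresentations.ideleGroup.finComp (K := K) v).toHomUnits (b i)) (t v))) *
        transferMap (whittakerFunctional ν₀ (continuous_adeleAddChar K)
          (ContRepresentation.Equiv.refl P.1.toContRep)) hτ T₀
          ⟨τ (toArch hcpt (glDiagonal n (mixedSpace K) (archTorusOfIdele n K b))) (e : E),
            apply_mem_archGardingSpace hτ _ e.2⟩ := by
  have hxS : ∀ v ∉ S, (RestrictedFamily.extend S fun v : S => t v) v = x₀ v := fun v hv =>
    RestrictedFamily.extend_apply_of_notMem S _ hv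
  rw [whittakerDepth_zero_pureTensor_glDiagonal P hτ hn ν₀ hΛ hprod S _ e hxS hfix b hb]
  congr 2
  refine Finset.prod_congr rfl fun v hv => ?_
  rw [RestrictedFamily.extend_apply_of_mem S _ hv]

end Euler

end Literature.NumberTheory.Automorphic
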